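import Summits.FinalStateConjecture.FinalStateConjecture.Theorems.SwallowTheDatumParametricKerrBurialEngine
import Summits.FinalStateConjecture.FinalStateConjecture.Theorems.SwallowTheDatumParametricKerrBurialStubEndChartDatum
import Literature.Geometry.Lorentzian.InitialDataLocality
import Literature.Geometry.Lorentzian.ModelDataProofs
import HarnessLib

/-!
# Stub `stub_modelData` of the line `Sketch` (crux `SwallowTheDatum.UniversalWitnessFamily`,
# item stmt-FinalStateConjecture-10051): the flat and the smoothed Schwarzschild model data on `ℝ³`

The two explicit IN/OUT model data of the Mao–Oh–Tao gluings which build the universal socket bag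
(`Theorems/SwallowTheDatumParametricKerrBurialEngine.lean`, §3):

* `FlatVacuumDatum F` — the flat datum `(δ, 0)` on `E3 = ℝ³`, vacuum everywhere;
* `SchwDatum m S` — for `m > 0`, a smooth datum on `ℝ³` which is EXACTLY time-symmetric isotropic
  Schwarzschild(`m`), `((1 + m/2|y|)⁴ δ, 0)`, and vacuum off the closed ball of radius `1/4`.

Construction. Both data are built from smooth coefficient fields on `E3`
(`exists_initialDataSet_of_contDiff`): the constant field `δ = innerSL`, resp. the conformally flat
field `(1 + (m/2) φ)⁴ δ` with the SMOOTHED INVERSE RADIUS `φ(y) = (1 − χ(y)) ‖y‖⁻¹`,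
`χ(y) = S(4 − 64‖y‖²)` (`S = Real.smoothTransition`; `χ = 1` near the closed ball `‖y‖ ≤ 1/8`, so
`φ` vanishes identically there, and `χ = 0` for `‖y‖ ≥ 1/4`, so `φ = ‖y‖⁻¹` there), `k = 0`.
Vacuum. The constraint map is local and natural under the inclusion of an open set `U ⊆ E3`
(`InitialDataSet.isVacuumAt_comap_iff`, `isVacuumAt_congr`; Bartnik–Isenberg 2004, §2): a datum on
`E3` whose sections agree on `U` with those of a VACUUM datum on `U` is vacuum at every point of `U`
(`vacAt_of_localModel`). The local models are the tree's `trivialData` on `Minkowski.slice = ⊤`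
(`trivialData_isVacuumConstraintSolution_holds`) and `Schwarzschild.conformalData` on
`exteriorRegion (1/4) = {1/4 < ‖y‖}` (`conformalData_isVacuumConstraintSolution_holds`: the conformal
factor `1 + m/2|y|` is harmonic, so `ψ⁴ δ` is scalar flat).

References: Bartnik–Isenberg 2004, §2 (locality of the constraints), §4.1 (conformally flat
time-symmetric data); Misner–Thorne–Wheeler 1973, (31.22); Christodoulou–Klainerman 1993, §1
(the trivial data); Corvino 2000, §4 (cut-off smoothing of a puncture).
-/

-- the doubled `FinalStateConjecture` path component is the summit/problem naming scheme, not a mistake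
set_option linter.dupNamespace false
-- instance problems on the nested operator type `E3 →L[ℝ] E3 →L[ℝ] ℝ` (e.g. `IsBoundedSMul ℝ _`, used by
-- `ContDiff.smul`) need one more level of pending instance synthesis than the default
set_option maxSynthPendingDepth 2

noncomputable section

namespace Summit.FinalStateConjecture.FinalStateConjecture.Theorems.SwallowTheDatum.UniversalWitnessFamily

open scoped Manifold ContDiff Topology InnerProductSpace
open Set Filter Function TopologicalSpace Literature.Geometry.Lorentzian
open Literature.Geometry.Manifold (OpenSubmanifold.mfderiv_subtype_val)
open Summit.FinalStateConjecture.FinalStateConjecture.Theorems.SwallowTheDatum.ParametricKerrBurial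
  (FlatVacuumDatum SchwDatum VacAt exists_initialDataSet_of_contDiff contDiff_cutoff cutoff_eq_zero
    cutoff_eq_one)

namespace ModelData

/-! ## §1 Vacuum at a point from a vacuum local model -/

/-- **Vacuum at a point from a vacuum local model.** If the sections of a datum `D` on `ℝ³` agree on
an open set `U ⊆ ℝ³` with those of a datum `D_U` on `U` solving the vacuum constraints, then `D`
satisfies the vacuum constraints at every point of `U`: the restriction `D|_U` (pull-back along the
inclusion, whose differential is the identity) has the sections of `D_U`, the constraint functions
at a point only see the germ of the data (`isVacuumAt_congr`), and they are natural under the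
inclusion (`isVacuumAt_comap_iff`). Bartnik–Isenberg 2004, §2. [cite: BartnikIsenberg2004, §2] -/
theorem vacAt_of_localModel (D : InitialDataSet (𝓡 3) E3) (U : Opens E3)
    (DU : InitialDataSet 𝓘(ℝ, E3) U)
    (hvac : ∀ [DU.metric.HasLeviCivita], DU.IsVacuumConstraintSolution)
    (hh : ∀ (u : U) (v w : E3), D.h.inner (u : E3) v w = DU.h.inner u v w)
    (hk : ∀ (u : U) (v w : E3), D.k (u : E3) v w = DU.k u v w) {y : E3} (hy : y ∈ U) :
    VacAt D y := by
  intro _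
  haveI hLU : DU.metric.HasLeviCivita := PseudoRiemannianMetric.hasLeviCivita _
  haveI hLc : (D.comap (Subtype.val : U → E3) (InitialDataSet.contMDiff_subtypeVal_succ U)
      (InitialDataSet.injective_mfderiv_subtypeVal U)).metric.HasLeviCivita :=
    PseudoRiemannianMetric.hasLeviCivita _
  have hh' : ∀ᶠ u : U in 𝓝 (⟨y, hy⟩ : U),
      (D.comap (Subtype.val : U → E3) (InitialDataSet.contMDiff_subtypeVal_succ U)
        (InitialDataSet.injective_mfderiv_subtypeVal U)).h.inner u = DU.h.inner u :=
    Filter.Eventually.of_forall fun u ↦ by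
      ext v w
      rw [InitialDataSet.comap_h_inner, OpenSubmanifold.mfderiv_subtype_val]
      exact hh u v w
  have hk' : ∀ᶠ u : U in 𝓝 (⟨y, hy⟩ : U),
      (D.comap (Subtype.val : U → E3) (InitialDataSet.contMDiff_subtypeVal_succ U)
        (InitialDataSet.injective_mfderiv_subtypeVal U)).k u = DU.k u :=
    Filter.Eventually.of_forall fun u ↦ by
      ext v w
      rw [InitialDataSet.comap_k, OpenSubmanifold.mfderiv_subtype_val]
      exact hk u v w
  have h1 := InitialDataSet.isVacuumAt_comap_iff D (InitialDataSet.contMDiff_subtypeVal_succ U)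
    (InitialDataSet.injective_mfderiv_subtypeVal U) (⟨y, hy⟩ : U)
  have h2 := InitialDataSet.isVacuumAt_congr (x := (⟨y, hy⟩ : U)) hh' hk'
  exact h1.1 (h2.2 (hvac ⟨y, hy⟩))

/-! ## §2 The flat vacuum datum -/

/-- **The flat vacuum datum `(δ, 0)` on `ℝ³` exists**: the constant coefficient fields `δ = innerSL`,
`k = 0` are those of an initial data set on `E3` (`exists_initialDataSet_of_contDiff`), which agrees on
`Minkowski.slice = ⊤` with the tree's trivial data `(ℝ³, δ, 0)`, a vacuum constraint solution
(`trivialData_isVacuumConstraintSolution_holds`); vacuum transfers by `vacAt_of_localModel`.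
Christodoulou–Klainerman 1993, §1 (the trivial data set). [cite: ChristodoulouKlainerman1993, §1] -/
theorem exists_flatVacuumDatum : ∃ F : InitialDataSet (𝓡 3) E3, FlatVacuumDatum F := by
  obtain ⟨F, hH, hK⟩ := exists_initialDataSet_of_contDiff
    (fun _ ↦ (innerSL ℝ : E3 →L[ℝ] E3 →L[ℝ] ℝ)) (fun _ ↦ 0) contDiff_const contDiff_const
    (fun _ v w ↦ real_inner_comm w v) (fun _ v hv ↦ real_inner_self_pos.2 hv) (fun _ _ _ ↦ rfl)
  have hh : ∀ y v w : E3, F.h.inner y v w = ⟪v, w⟫_ℝ := fun y v w ↦ by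
    rw [← InitialDataSet.coordH_apply, hH]
    rfl
  have hk : ∀ y : E3, F.k y = 0 := fun y ↦ congrFun hK y
  refine ⟨F, fun y v w ↦ ⟨hh y v w, hk y⟩, fun y ↦ ?_⟩
  exact vacAt_of_localModel F Minkowski.slice trivialData trivialData_isVacuumConstraintSolution_holds
    (fun u v w ↦ by rw [hh, trivialData_h_inner]; rfl) (fun u v w ↦ by rw [hk, trivialData_k]; rfl)
    (Minkowski.mem_slice y)

/-! ## §3 The smoothed Schwarzschild datum -/

/-- **A smoothed inverse radius.** There is a `C^∞` function `φ ≥ 0` on `E3` with `φ(y) = ‖y‖⁻¹` for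
`‖y‖ ≥ 1/4`: `φ = (1 − χ) ‖·‖⁻¹` with the cut-off `χ(y) = S(4 − 64‖y‖²)` (`= 1` near the closed ball
`‖y‖ ≤ 1/8`, where `φ` therefore vanishes identically; `= 0` beyond radius `1/4`; `0 ≤ χ ≤ 1`).
Corvino 2000, §4 (cut-off functions). [folklore] -/
theorem exists_smoothedInvRadius :
    ∃ φ : E3 → ℝ, ContDiff ℝ ∞ φ ∧ (∀ y, 0 ≤ φ y) ∧ ∀ y : E3, 1 / 4 ≤ ‖y‖ → φ y = ‖y‖⁻¹ := by
  have hρ : (0 : ℝ) < 1 / 8 := by norm_num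
  refine ⟨fun y ↦ (1 - Real.smoothTransition (4 - ‖y‖ ^ 2 / (1 / 8 : ℝ) ^ 2)) * ‖y‖⁻¹,
    contDiff_iff_contDiffAt.2 fun y ↦ ?_, fun y ↦ ?_, fun y hy ↦ ?_⟩
  · by_cases hy : 1 / 8 < ‖y‖
    · have hy0 : y ≠ 0 := norm_pos_iff.1 (hρ.trans hy)
      exact (contDiff_const.sub (contDiff_cutoff (1 / 8 : ℝ))).contDiffAt.mul
        ((contDiffAt_norm ℝ hy0).inv (norm_ne_zero_iff.2 hy0))
    · refine (contDiffAt_const (c := (0 : ℝ))).congr_of_eventuallyEq ?_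
      have hy' : ‖y‖ < 3 / 2 * (1 / 8 : ℝ) := by linarith [not_lt.1 hy]
      filter_upwards [(isOpen_lt continuous_norm continuous_const).mem_nhds hy'] with z hz
      rw [cutoff_eq_one hρ hz, sub_self, zero_mul]
  · exact mul_nonneg (sub_nonneg.2 (Real.smoothTransition.le_one _)) (inv_nonneg.2 (norm_nonneg _))
  · have hy2 : 2 * (1 / 8 : ℝ) ≤ ‖y‖ := by linarith
    change (1 - Real.smoothTransition (4 - ‖y‖ ^ 2 / (1 / 8 : ℝ) ^ 2)) * ‖y‖⁻¹ = ‖y‖⁻¹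
    rw [cutoff_eq_zero hρ hy2, sub_zero, one_mul]

/-- The origin does not lie in the exterior region `{1/4 < ‖y‖}`. [folklore] -/
theorem zero_notMem_exteriorRegion_quarter : (0 : E3) ∉ (exteriorRegion (1 / 4) : Set E3) := by
  intro h
  rw [SetLike.mem_coe, mem_exteriorRegion, norm_zero] at h
  norm_num at h

/-- **The smoothed Schwarzschild(`m`) datum.** For `m > 0` there is a smooth datum `S` on `ℝ³` with
`h_S = (1 + (m/2) φ)⁴ δ`, `k_S = 0` (`φ` the smoothed inverse radius of `exists_smoothedInvRadius`;
positive definite since `φ ≥ 0`), hence EXACTLY `((1 + m/2|y|)⁴ δ, 0)` on `{1/4 < ‖y‖}`, where it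
agrees with the conformal Schwarzschild data `Schwarzschild.conformalData` on `exteriorRegion (1/4)`,
a vacuum constraint solution (`conformalData_isVacuumConstraintSolution_holds`: `ψ = 1 + m/2|y|` is
harmonic, `R(ψ⁴ δ) = −8 ψ⁻⁵ Δψ = 0`, `k = 0`); vacuum transfers by `vacAt_of_localModel`.
Misner–Thorne–Wheeler 1973, (31.22); Bartnik–Isenberg 2004, §4.1. [cite: BartnikIsenberg2004, §4.1] -/
theorem exists_schwDatum (m : ℝ) (hm : 0 < m) : ∃ S : InitialDataSet (𝓡 3) E3, SchwDatum m S := by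
  obtain ⟨φ, hφs, hφ0, hφfar⟩ := exists_smoothedInvRadius
  -- the coefficient field `(1 + (m/2) φ)⁴ δ`
  have hWpos : ∀ y, 0 < 1 + m / 2 * φ y := fun y ↦ by
    have h0 := hφ0 y
    positivity
  have hg : ContDiff ℝ ∞ fun y : E3 ↦ (1 + m / 2 * φ y) ^ 4 • (innerSL ℝ : E3 →L[ℝ] E3 →L[ℝ] ℝ) :=
    ((contDiff_const.add (contDiff_const.mul hφs)).pow 4).smul contDiff_const
  obtain ⟨S, hH, hK⟩ := exists_initialDataSet_of_contDiff
    (fun y : E3 ↦ (1 + m / 2 * φ y) ^ 4 • (innerSL ℝ : E3 →L[ℝ] E3 →L[ℝ] ℝ)) (fun _ ↦ 0) hg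
    contDiff_const
    (fun y v w ↦ by
      change (1 + m / 2 * φ y) ^ 4 * ⟪v, w⟫_ℝ = (1 + m / 2 * φ y) ^ 4 * ⟪w, v⟫_ℝ
      rw [real_inner_comm])
    (fun y v hv ↦ by
      change 0 < (1 + m / 2 * φ y) ^ 4 * ⟪v, v⟫_ℝ
      exact mul_pos (pow_pos (hWpos y) 4) (real_inner_self_pos.2 hv))
    (fun _ _ _ ↦ rfl)
  -- its sections
  have hSh : ∀ y v w : E3, S.h.inner y v w = (1 + m / 2 * φ y) ^ 4 * ⟪v, w⟫_ℝ := fun y v w ↦ by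
    rw [← InitialDataSet.coordH_apply, hH]
    rfl
  have hSk : ∀ y : E3, S.k y = 0 := fun y ↦ congrFun hK y
  -- the exact Schwarzschild form beyond radius `1/4`
  have hfar : ∀ y : E3, 1 / 4 < ‖y‖ →
      ∀ v w : E3, S.h.inner y v w = (1 + m / (2 * ‖y‖)) ^ 4 * ⟪v, w⟫_ℝ := fun y hy v w ↦ by
    rw [hSh, hφfar y hy.le, show m / 2 * ‖y‖⁻¹ = m / (2 * ‖y‖) by ring]
  refine ⟨S, fun y hy ↦ ⟨hfar y hy, hSk y⟩, fun y hy ↦ ?_⟩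
  -- vacuum beyond radius `1/4`: the local model is the conformal Schwarzschild datum on `{1/4 < ‖y‖}`
  exact vacAt_of_localModel S (exteriorRegion (1 / 4))
    (Schwarzschild.conformalData (M := m) (exteriorRegion (1 / 4)) hm.le
      zero_notMem_exteriorRegion_quarter)
    (Schwarzschild.conformalData_isVacuumConstraintSolution_holds (M := m)
      (U := exteriorRegion (1 / 4)) hm.le zero_notMem_exteriorRegion_quarter)
    (fun u v w ↦ by
      rw [Schwarzschild.conformalData_h_inner, Schwarzschild.conformalInner_apply,
        Schwarzschild.conformalFactor_apply]
      exact hfar u u.2 v w)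
    (fun u v w ↦ by rw [hSk, Schwarzschild.conformalData_k]; rfl) hy

end ModelData

/-! ## §4 The stub -/

/-- **Stub `stub_modelData`** (registered signature, line `Sketch`, crux item
stmt-FinalStateConjecture-10051; conjuncts 1–2 of the sibling crux 10052's `stub_explicit`): the flat
vacuum datum `(δ, 0)` on `ℝ³` exists (`ModelData.exists_flatVacuumDatum`), and for every `m > 0` a
smooth datum on `ℝ³` exists which is exactly `((1 + m/2|y|)⁴ δ, 0)` and vacuum off the ball of
radius `1/4` (`ModelData.exists_schwDatum`). Christodoulou–Klainerman 1993, §1;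
Misner–Thorne–Wheeler 1973, (31.22); Bartnik–Isenberg 2004, §2, §4.1. [folklore] -/
theorem stub_modelData :
  (∃ F : InitialDataSet (𝓡 3) E3, FlatVacuumDatum F) ∧
  (∀ m : ℝ, 0 < m → ∃ S : InitialDataSet (𝓡 3) E3, SchwDatum m S) :=
  ⟨ModelData.exists_flatVacuumDatum, ModelData.exists_schwDatum⟩

end Summit.FinalStateConjecture.FinalStateConjecture.Theorems.SwallowTheDatum.UniversalWitnessFamily

end
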